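import Summits.ValiantsHypothesis.ValiantsHypothesis.Theses.RealTau
import Literature.Computability.AlgebraicComplexity.RealTauKnownCases

/-!
# Crux `RealTau.RealTauRefined` (stmt-ValiantsHypothesis-18101), line `fischer-powers` —
# registered stub `stub_commonSupport` (common-support normalisation)

**Claim settled (`WaringOnCurve → EqualPowerSigned`).** Suppose that, for one absolute `a`, every
nonzero signed sum `Σ_{i<K} ε_i (Σ_{l<T} c_il X^(e_l))^m` of `m`-th powers of `K` real linear forms
in COMMON monomials `X^(e_0) < ⋯ < X^(e_{T-1})` (`ε_i = ±1`, `e` strictly increasing) has at most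
`2^(a(m+1)) (K+T+2)^a` distinct real zeros.  Then every nonzero `Σ_{i<K} ε_i h_i^m` with ARBITRARY
`T`-sparse real `h_i` has at most `2^(2a(m+1)) (K+T+2)^(2a)` distinct real zeros (output exponent
`2a`).

**Proof.**  Let `S ⊇ supp (h i)` be the union of the supports, a set of `N ≤ K T` exponents,
enumerated increasingly by `e := S.orderEmbOfFin rfl : Fin N ↪o ℕ`.  Then
`h i = Σ_{l<N} C ((h i).coeff (e l)) * X^(e l)` (`Polynomial.as_sum_support_C_mul_X_pow`, summed
over `S ⊇ supp (h i)` and re-indexed along `e`, `Finset.map_orderEmbOfFin_univ`), so the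
hypothesis at `(K, m, N)` bounds the number of zeros by `2^(a(m+1)) (K+N+2)^a`, and
`K + N + 2 ≤ K + K T + 2 ≤ (K+T+2)^2`, `a (m+1) ≤ 2a (m+1)` re-absorb it.

Unconditional (axioms `propext`, `Classical.choice`, `Quot.sound`); elementary bookkeeping inside
Tavenas' Lemme 3.26 normal form (S. Tavenas, *Bornes inférieures et supérieures dans les circuits
arithmétiques*, PhD thesis, ENS Lyon 2014, Ch. 3 §2.1).
-/

noncomputable section

-- single-conjunct layout: Sub = Summit, duplicated namespace component intended
set_option linter.dupNamespace false

namespace Summit.ValiantsHypothesis.ValiantsHypothesis.Theorems.RealTauRealTauRefined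

open Polynomial Finset
open Literature.Computability.AlgebraicComplexity

/-- **Expansion of a polynomial along the increasing enumeration of a superset of its support.**
If `supp p ⊆ S` and `#S = N`, then `p = Σ_{l<N} C (p.coeff (e l)) * X^(e l)` for the increasing
enumeration `e = S.orderEmbOfFin hN : Fin N ↪o ℕ` of `S`. [folklore] -/
theorem eq_sum_C_mul_X_pow_orderEmbOfFin (p : ℝ[X]) {S : Finset ℕ} (hS : p.support ⊆ S) {N : ℕ}
    (hN : S.card = N) :
    p = ∑ l : Fin N, C (p.coeff (S.orderEmbOfFin hN l)) * X ^ (S.orderEmbOfFin hN l : ℕ) := by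
  have h1 : p = ∑ n ∈ S, C (p.coeff n) * X ^ n := by
    conv_lhs => rw [p.as_sum_support_C_mul_X_pow]
    refine Finset.sum_subset hS fun n _ hn => ?_
    rw [notMem_support_iff.mp hn, C_0, zero_mul]
  have h2 := Finset.sum_map Finset.univ (S.orderEmbOfFin hN).toEmbedding
    (fun n => C (p.coeff n) * X ^ n)
  rw [Finset.map_orderEmbOfFin_univ] at h2
  exact h1.trans h2

/-- **Stub `stub_commonSupport` (common support, `WaringOnCurve → EqualPowerSigned`).** If the
Waring-on-the-monomial-curve bound holds with exponent `a`, then every nonzero `Σ_{i<K} ε_i h_i^m`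
with `ε_i = ±1` and `T`-sparse real `h_i` has at most `2^(2a(m+1)) (K+T+2)^(2a)` distinct real
zeros: enumerate `S = ⋃_i supp (h i)` (`#S ≤ K T`) increasingly by `S.orderEmbOfFin rfl`, write
each `h i` as a linear form in the common monomials (`eq_sum_C_mul_X_pow_orderEmbOfFin`), apply the
hypothesis at `(K, m, #S)` and re-absorb `K + K T + 2 ≤ (K+T+2)^2`. -/
theorem stub_commonSupport :
    (∃ a : ℕ, ∀ (K m T : ℕ) (ε : Fin K → ℤˣ) (c : Fin K → Fin T → ℝ) (e : Fin T → ℕ), StrictMono e →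
      (∑ i, C (((ε i : ℤ) : ℝ)) * (∑ l, C (c i l) * X ^ (e l)) ^ m) ≠ 0 →
        (∑ i, C (((ε i : ℤ) : ℝ)) * (∑ l, C (c i l) * X ^ (e l)) ^ m).roots.toFinset.card
          ≤ 2 ^ (a * (m + 1)) * (K + T + 2) ^ a) →
    ∃ a : ℕ, ∀ (K m T : ℕ) (ε : Fin K → ℤˣ) (h : Fin K → Polynomial ℝ),
      (∀ i, (h i).support.card ≤ T) →
        (∑ i, C (((ε i : ℤ) : ℝ)) * h i ^ m) ≠ 0 →
          (∑ i, C (((ε i : ℤ) : ℝ)) * h i ^ m).roots.toFinset.card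
            ≤ 2 ^ (a * (m + 1)) * (K + T + 2) ^ a := by
  rintro ⟨a, ha⟩
  refine ⟨2 * a, fun K m T ε h hT hne => ?_⟩
  classical
  -- the common support `S ⊇ supp (h i)`, `#S ≤ K T`
  obtain ⟨S, hsub, hcard⟩ : ∃ S : Finset ℕ, (∀ i, (h i).support ⊆ S) ∧ S.card ≤ K * T := by
    refine ⟨Finset.univ.biUnion fun i => (h i).support,
      fun i => Finset.subset_biUnion_of_mem (fun i => (h i).support) (Finset.mem_univ i), ?_⟩
    simpa using Finset.card_biUnion_le_card_mul Finset.univ (fun i => (h i).support) T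
      fun i _ => hT i
  -- rewrite every `h i` as a linear form in the common monomials `X^(e l)`, `e = S.orderEmbOfFin`
  have hrw : (∑ i, C (((ε i : ℤ) : ℝ)) * h i ^ m) =
      ∑ i, C (((ε i : ℤ) : ℝ)) *
        (∑ l : Fin S.card, C ((h i).coeff (S.orderEmbOfFin rfl l)) *
          X ^ (S.orderEmbOfFin rfl l : ℕ)) ^ m :=
    Finset.sum_congr rfl fun i _ => by rw [← eq_sum_C_mul_X_pow_orderEmbOfFin (h i) (hsub i) rfl]
  rw [hrw] at hne ⊢
  refine (ha K m S.card ε (fun i l => (h i).coeff (S.orderEmbOfFin rfl l))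
    (fun l => S.orderEmbOfFin rfl l) (S.orderEmbOfFin rfl).strictMono hne).trans ?_
  -- re-absorb: `K + #S + 2 ≤ (K + T + 2)^2` and `a ↦ 2a`
  have hbase : K + S.card + 2 ≤ (K + T + 2) ^ 2 := by nlinarith [hcard]
  calc 2 ^ (a * (m + 1)) * (K + S.card + 2) ^ a
      ≤ 2 ^ (2 * a * (m + 1)) * ((K + T + 2) ^ 2) ^ a :=
        Nat.mul_le_mul
          (Nat.pow_le_pow_right (by norm_num) (Nat.mul_le_mul_right (m + 1) (by omega)))
          (Nat.pow_le_pow_left hbase a)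
    _ = 2 ^ (2 * a * (m + 1)) * (K + T + 2) ^ (2 * a) := by rw [← pow_mul]

end Summit.ValiantsHypothesis.ValiantsHypothesis.Theorems.RealTauRealTauRefined
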